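import Summits.CriticalPhenomena.Ising3DConformalLimit.Theses.SubPtolemyInterlacing
import Literature.Probability.LatticeModels.CriticalUrsellFourSign
import Literature.Probability.LatticeModels.CriticalAxisRatioRegularity
import HarnessLib

/-!
# Line `Sketch` for the crux `SubPtolemyInterlacing.Interlacing` (stmt-CriticalPhenomena-15702) — stub `stub_boxLimit`

The box limit: an eventual free-box inequality `S₄^L P₂^L ≤ P₁^L P₃^L` at `β_c` passes to `Λ_L ↑ ℤ³`
(`criticalCorr_wellDefined_holds`) and gives the interlacing inequality at `(a,b,c)` in the crux's spelling.

Helper file of the line `Sketch` (lead skeleton `Cruxes/Interlacing/Lines/Sketch.lean`): proves the registered stub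
`stub_boxLimit` verbatim (name + signature). No definitions, no named facts, no sorry.
-/

noncomputable section

namespace Summit.CriticalPhenomena.Ising3DConformalLimit.Cruxes.Interlacing.Sketch

open Filter MeasureTheory
open scoped symmDiff Topology
open Literature.Probability.LatticeModels Literature.Probability.Percolation

/-- Dictionary between the two spellings of an axis point: `(k : ℤ) • e₀ = Pi.single 0 k`. [folklore] -/
private theorem axisPoint_eq_single (k : ℕ) :
    ((k : ℕ) : ℤ) • (Pi.single 0 1 : Site 3) = Pi.single 0 ((k : ℕ) : ℤ) := by
  rw [← Pi.single_smul, smul_eq_mul, mul_one]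

/-- **Stub `stub_boxLimit`** of the line `Sketch` (crux stmt-CriticalPhenomena-15702): The box limit: an eventual free-box inequality `S₄^L P₂^L ≤ P₁^L P₃^L` at `β_c` passes to `Λ_L ↑ ℤ³` (`criticalCorr_wellDefined_holds`) and gives the interlacing inequality at `(a,b,c)` in the crux's spelling. -/
theorem stub_boxLimit : ∀ a b c : ℕ,
    (∀ᶠ L : ℕ in atTop,
      isingExpect (zdGraph 3) (box 3 L) (criticalBeta 3) 0 .free
          (spinMonomial ![(Pi.single 0 ((0 : ℕ) : ℤ)), (Pi.single 0 ((a : ℕ) : ℤ)), (Pi.single 0 ((a + b : ℕ) : ℤ)), (Pi.single 0 ((a + b + c : ℕ) : ℤ))]) *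
          (isingTwoPoint (zdGraph 3) (box 3 L) (criticalBeta 3) 0 .free (Pi.single 0 ((0 : ℕ) : ℤ)) (Pi.single 0 ((a + b : ℕ) : ℤ)) *
            isingTwoPoint (zdGraph 3) (box 3 L) (criticalBeta 3) 0 .free (Pi.single 0 ((a : ℕ) : ℤ)) (Pi.single 0 ((a + b + c : ℕ) : ℤ))) ≤
        isingTwoPoint (zdGraph 3) (box 3 L) (criticalBeta 3) 0 .free (Pi.single 0 ((0 : ℕ) : ℤ)) (Pi.single 0 ((a : ℕ) : ℤ)) *
            isingTwoPoint (zdGraph 3) (box 3 L) (criticalBeta 3) 0 .free (Pi.single 0 ((a + b : ℕ) : ℤ)) (Pi.single 0 ((a + b + c : ℕ) : ℤ)) *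
          (isingTwoPoint (zdGraph 3) (box 3 L) (criticalBeta 3) 0 .free (Pi.single 0 ((0 : ℕ) : ℤ)) (Pi.single 0 ((a + b + c : ℕ) : ℤ)) *
            isingTwoPoint (zdGraph 3) (box 3 L) (criticalBeta 3) 0 .free (Pi.single 0 ((a : ℕ) : ℤ)) (Pi.single 0 ((a + b : ℕ) : ℤ)))) →
      criticalCorr 3 4 ![((0 : ℕ) : ℤ) • (Pi.single 0 1 : Site 3), ((a : ℕ) : ℤ) • (Pi.single 0 1 : Site 3), ((a + b : ℕ) : ℤ) • (Pi.single 0 1 : Site 3),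
          ((a + b + c : ℕ) : ℤ) • (Pi.single 0 1 : Site 3)] *
          (criticalCorr 3 2 ![((0 : ℕ) : ℤ) • (Pi.single 0 1 : Site 3), ((a + b : ℕ) : ℤ) • (Pi.single 0 1 : Site 3)] *
            criticalCorr 3 2 ![((a : ℕ) : ℤ) • (Pi.single 0 1 : Site 3), ((a + b + c : ℕ) : ℤ) • (Pi.single 0 1 : Site 3)]) ≤
        criticalCorr 3 2 ![((0 : ℕ) : ℤ) • (Pi.single 0 1 : Site 3), ((a : ℕ) : ℤ) • (Pi.single 0 1 : Site 3)] *
            criticalCorr 3 2 ![((a + b : ℕ) : ℤ) • (Pi.single 0 1 : Site 3), ((a + b + c : ℕ) : ℤ) • (Pi.single 0 1 : Site 3)] *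
          (criticalCorr 3 2 ![((0 : ℕ) : ℤ) • (Pi.single 0 1 : Site 3), ((a + b + c : ℕ) : ℤ) • (Pi.single 0 1 : Site 3)] *
            criticalCorr 3 2 ![((a : ℕ) : ℤ) • (Pi.single 0 1 : Site 3), ((a + b : ℕ) : ℤ) • (Pi.single 0 1 : Site 3)]) := by
  intro a b c hev
  simp only [axisPoint_eq_single]
  have hmem : (BoundaryCondition.free : BoundaryCondition (Site 3)) ∈
      ({.free, .plus, .minus} : Set (BoundaryCondition (Site 3))) := by simp
  have h4 : ∀ y : Fin 4 → Site 3, Tendsto (fun L : ℕ => isingExpect (zdGraph 3) (box 3 L)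
      (criticalBeta 3) 0 .free (spinMonomial y)) atTop (𝓝 (criticalCorr 3 4 y)) := fun y =>
    criticalCorr_wellDefined_holds (d := 3) le_rfl 4 y .free hmem
  have hT : ∀ u v : Site 3, Tendsto (fun L : ℕ => isingTwoPoint (zdGraph 3) (box 3 L)
      (criticalBeta 3) 0 .free u v) atTop (𝓝 (criticalCorr 3 2 ![u, v])) := by
    intro u v
    have h := criticalCorr_wellDefined_holds (d := 3) le_rfl 2 ![u, v] .free hmem
    refine Tendsto.congr (fun L => ?_) h
    simp only [isingTwoPoint, spinMonomial_two]
  exact le_of_tendsto_of_tendsto ((h4 _).mul ((hT _ _).mul (hT _ _)))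
    (((hT _ _).mul (hT _ _)).mul ((hT _ _).mul (hT _ _))) hev

end Summit.CriticalPhenomena.Ising3DConformalLimit.Cruxes.Interlacing.Sketch

end
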